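import Summits.CriticalPhenomena.PercolationContinuityZ3.Theorems.FK.PressureFieldDerivative
import Literature.Probability.LatticeModels.CriticalGibbsUniqueness
import Literature.Probability.LatticeModels.PlusMinusStateGibbs
import Literature.Probability.LatticeModels.IsingVolumeMonotonicity
import HarnessLib

/-!
# UNIQUENESS OF THE INFINITE-VOLUME GIBBS MEASURE AT EVERY NONZERO FIELD: `|𝒢(β,h)| = 1` FOR ALL `β > 0`, `h ≠ 0`
# — AND AT EVERY `(β,h)` WHERE `ψ(β,·)` IS DIFFERENTIABLE (Friedli–Velenik 2017, Thm. 3.25 (1) and Thm. 3.34, WITHOUT Lee–Yang)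

Claimed R42 (8)(c) in the cell INBOX at 2026-08-29T01:14:38Z by fkp-10a gen 357 (NEW CLAIM #2 of the gen), addressed to coordinator fk-4 gen 288 (seated 01:00Z 2026-08-29 by l.8634; R160 = row FO-10a-g357); lineage row FO-10a-g357f (self-suggested), package g357-field, label HF-E.
Helper file of the `fk-continuity` build cell (bschramm lane; `--supports stmt-CriticalPhenomena-4575`); builds on
p205010 (kernel theorem, internal audit signed; external expert review pending). No definitions, no named facts, no
sorries; standard axioms. UNCONDITIONAL (nearest-neighbour Ising model on `ℤ^d`, `d ≥ 1`, `β > 0`).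

Friedli–Velenik prove uniqueness at `h ≠ 0` (Thm. 3.25 (1)) from the differentiability of the pressure in `h`, which
they obtain from the Lee–Yang theorem; the tree has that differentiability WITHOUT Lee–Yang (`hasDerivAt_pressure_field`,
`PressureFieldDerivative`, from GHS concavity). The implication "ψ(β,·) differentiable at `h` ⇒ unique Gibbs measure at
`(β,h)`" (Thm. 3.34, 1 ⇒ 3 ⇒ uniqueness via Thm. 3.28) is proved here for EVERY real `h`, in DLR form:

* `plusCorr_singleton_le_isingCorr_plus_box`, `isingCorr_minus_box_singleton_le_minusCorr` — at EVERY field `h ∈ ℝ`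
  the finite-volume `±` magnetisations bound the infinite-volume ones (FKG volume monotonicity,
  `isingExpect_fixed_anti_volume`, and the spin flip), `plusCorr_singleton_eq_zero_site` / `minusCorr_singleton_eq_zero_site`
  (translation invariance at every field);
* **`mul_plusCorr_le_slope_pressure_field`**, **`slope_pressure_field_le_mul_minusCorr`** — the one-sided chord bounds
  `β ⟨σ_0⟩⁺_{β,h} ≤ slope ψ(β,·) h y` (`y > h`) and `slope ψ(β,·) y h ≤ β ⟨σ_0⟩⁻_{β,h}` (`y < h`) at EVERY real `h` (convexity
  of the finite-volume pressures with `+` / `−` boundary condition, `convexOn_pressureIn_field`, their derivative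
  `hasDerivAt_pressureIn_field`, and `ψ^{±}_{Λ_L} → ψ`): Friedli–Velenik Prop. 3.29 / (3.47) in chord form,
  `∂⁺ψ/∂h ≥ β m⁺(β,h)`, `∂⁻ψ/∂h ≤ β m⁻(β,h)`;
* **`minusCorr_singleton_eq_plusCorr_singleton_of_differentiableAt`** — if `ψ(β,·)` is differentiable at `h` (`β > 0`),
  then `⟨σ_0⟩⁻_{β,h} = ⟨σ_0⟩⁺_{β,h}` (`β m⁺ ≤ ψ' ≤ β m⁻` and `m⁻ ≤ m⁺`);
* **`hasUniqueGibbsMeasure_of_differentiableAt_pressure`** — **Friedli–Velenik Thm. 3.34 (1 ⇒ uniqueness), every `h`**: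
  `DifferentiableAt ℝ ψ(β,·) h → HasUniqueGibbsMeasure (isingSpecification (zdGraph d) β h)` (the single-site gap
  `μ⁺_{B(n)}(σ_i = 1) − μ⁻_{B(n)}(σ_i = 1) → (⟨σ_0⟩⁺ − ⟨σ_0⟩⁻)/2 = 0` feeds the tree's DLR criterion
  `subsingleton_gibbsMeasures_isingSpecification_of_tendsto`; existence by `exists_plusMeasure_holds`);
* **`hasUniqueGibbsMeasure_of_field_ne_zero`** — **FRIEDLI–VELENIK THM. 3.25 (1): FOR `d ≥ 1`, `β > 0` AND EVERY `h ≠ 0`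
  THE NEAREST-NEIGHBOUR ISING MODEL ON `ℤ^d` HAS EXACTLY ONE INFINITE-VOLUME GIBBS MEASURE** (the tree had this only
  for `4dβ < 1`, `isingSpecification_SMT_unique`); `hasUniqueGibbsMeasure_of_le_criticalBeta'` re-derives the zero-field
  uniqueness for `0 < β ≤ β_c(d)`, `d ≥ 2`, through the same door (`differentiableAt_pressure_zero_of_le_criticalBeta`);
* `spinCorr_eq_plusCorr_of_field_ne_zero` — consequently every `μ ∈ 𝒢(β,h)`, `h ≠ 0`, has the correlations of the plus
  state, `⟨σ_A⟩_μ = ⟨σ_A⟩⁺_{β,h}` for all finite `A`.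

## References

* S. Friedli, Y. Velenik, *Statistical Mechanics of Lattice Systems*, CUP (2017), Thm. 3.25 (1), Thm. 3.28, Prop. 3.29,
  Thm. 3.34, Lemma 3.22–3.23, Thm. 3.17, Thm. 6.26, eq. (6.70). [FriedliVelenik2017]
* J. L. Lebowitz, A. Martin-Löf, Comm. Math. Phys. 25 (1972) 276–282. [LebowitzMartinlof1972]
* H.-O. Georgii, *Gibbs Measures and Phase Transitions*, 2nd ed., de Gruyter (2011), Ch. 8. [Georgii2011]
-/

noncomputable section

namespace Summit.CriticalPhenomena.PercolationContinuityZ3.Theorems.FK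

namespace IsingSusceptibility

open MeasureTheory Filter Topology Finset Set
open Literature.Probability.LatticeModels
open Summit.CriticalPhenomena.PercolationContinuityZ3.Theorems.FK.ConcaveLimit

variable {d : ℕ}

/-! ### Finite-volume `±` magnetisations bound the infinite-volume ones, at every field -/

/-- **`⟨σ_x⟩⁺_{β,h} ≤ ⟨σ_x⟩⁺_{B(L);β,h}`** for `β ≥ 0` and EVERY `h ∈ ℝ` (the plus box magnetisations decrease to the plus
state by FKG, Friedli–Velenik Lemma 3.22 / Thm. 3.17). [cite: FriedliVelenik2017, Lemma 3.22 and Thm. 3.17] -/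
theorem plusCorr_singleton_le_isingCorr_plus_box {β : ℝ} (hβ : 0 ≤ β) (h : ℝ) (x : Site d) (L : ℕ) :
    plusCorr d β h {x} ≤ isingCorr (zdGraph d) (box d L) β h .plus {x} := by
  have hanti : Antitone fun L : ℕ => isingCorr (zdGraph d) (box d L) β h .plus {x} := by
    intro L L' hLL'
    simp only [isingCorr, spinProduct_singleton]
    exact isingExpect_fixed_anti_volume (zdGraph d) hβ (box_mono d hLL') h (η := 1) (fun _ _ => rfl)
      (spinAt_mono x) (measurable_spinAt x)
  exact hanti.le_of_tendsto (tendsto_isingCorr_plus_box hβ h {x}) L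

/-- **`⟨σ_x⟩⁻_{B(L);β,h} ≤ ⟨σ_x⟩⁻_{β,h}`** for `β ≥ 0` and EVERY `h ∈ ℝ` (spin flip of the previous bound at field `−h`:
`⟨σ_x⟩⁻_{Λ;β,h} = −⟨σ_x⟩⁺_{Λ;β,−h}`, `⟨σ_x⟩⁻_{β,h} = −⟨σ_x⟩⁺_{β,−h}`). [cite: FriedliVelenik2017, Lemma 3.23 and §3.7.1] -/
theorem isingCorr_minus_box_singleton_le_minusCorr {β : ℝ} (hβ : 0 ≤ β) (h : ℝ) (x : Site d) (L : ℕ) :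
    isingCorr (zdGraph d) (box d L) β h .minus {x} ≤ minusCorr d β h {x} := by
  rw [isingCorr_minus_eq_flip, minusCorr_eq_plusCorr_neg hβ h {x}, Finset.card_singleton, pow_one, neg_one_mul,
    neg_one_mul, neg_le_neg_iff]
  exact plusCorr_singleton_le_isingCorr_plus_box hβ (-h) x L

/-- `⟨σ_x⟩⁺_{β,h} = ⟨σ_0⟩⁺_{β,h}` for every real `h` (translation invariance of the plus state at every field).
[cite: FriedliVelenik2017, Thm. 3.17] -/
theorem plusCorr_singleton_eq_zero_site {β : ℝ} (hβ : 0 ≤ β) (h : ℝ) (x : Site d) :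
    plusCorr d β h {x} = plusCorr d β h {0} := by
  have hx : ({0} : Finset (Site d)).map (Site.shift x).toEmbedding = {x} := by
    rw [Finset.map_singleton]
    simp [Site.shift]
  rw [← hx, plusCorr_map_shift hβ h {0} x]

/-- `⟨σ_x⟩⁻_{β,h} = ⟨σ_0⟩⁻_{β,h}` for every real `h`. [cite: FriedliVelenik2017, Thm. 3.17 and §3.7.1] -/
theorem minusCorr_singleton_eq_zero_site {β : ℝ} (hβ : 0 ≤ β) (h : ℝ) (x : Site d) :
    minusCorr d β h {x} = minusCorr d β h {0} := by
  rw [minusCorr_eq_plusCorr_neg hβ h {x}, minusCorr_eq_plusCorr_neg hβ h {0}, plusCorr_singleton_eq_zero_site hβ (-h) x,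
    Finset.card_singleton, Finset.card_singleton]

/-- `⟨σ_0⟩⁻_{β,h} ≤ ⟨σ_0⟩⁺_{β,h}` for every real `h` (`−` boundary condition below `+`, FKG, in the limit).
[cite: FriedliVelenik2017, Lemma 3.23] -/
theorem minusCorr_singleton_le_plusCorr_singleton {β : ℝ} (hβ : 0 ≤ β) (h : ℝ) (x : Site d) :
    minusCorr d β h {x} ≤ plusCorr d β h {x} := by
  refine le_of_tendsto_of_tendsto' (tendsto_isingCorr_minus_box hβ h {x}) (tendsto_isingCorr_plus_box hβ h {x}) fun L => ?_
  simp only [isingCorr, spinProduct_singleton]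
  exact isingExpect_fixed_mono (zdGraph d) hβ (box d L) h (fun y => neg_one_le_intUnits ((1 : SpinConfig (Site d)) y))
    (spinAt_mono x) (measurable_spinAt x)

/-! ### One-sided chord bounds of `ψ(β,·)` at every field: `∂⁺ψ/∂h ≥ β m⁺`, `∂⁻ψ/∂h ≤ β m⁻` -/

/-- **`β ⟨σ_0⟩⁺_{β,h} ≤ slope ψ(β,·) h y` for every `h < y`** (`β ≥ 0`, any real `h`): the finite-volume pressures
`ψ⁺_{B(L)}(β,·)` are convex with derivative `β |B(L)|⁻¹ Σ_x ⟨σ_x⟩⁺_{B(L);β,h} ≥ β ⟨σ_0⟩⁺_{β,h}` at `h`, and converge to `ψ`.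
[cite: FriedliVelenik2017, Prop. 3.29 and eq. (3.47); Thm. 3.6] -/
theorem mul_plusCorr_le_slope_pressure_field {β : ℝ} (hβ : 0 ≤ β) {h y : ℝ} (hhy : h < y) :
    β * plusCorr d β h {0} ≤ slope (fun t => pressure d β t) h y := by
  have hN : ∀ L : ℕ, (0 : ℝ) < #(box d L) := fun L => by exact_mod_cast Finset.card_pos.2 (box_nonempty d L)
  have hslope : ∀ L : ℕ, β * plusCorr d β h {0} ≤ slope (fun t => pressureIn (zdGraph d) (box d L) β t .plus) h y := by
    intro L
    refine le_trans ?_ ((convexOn_pressureIn_field (zdGraph d) (box d L) β .plus).le_slope_of_hasDerivAt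
      (mem_univ h) (mem_univ y) hhy (hasDerivAt_pressureIn_field (zdGraph d) (box d L) β h .plus))
    refine mul_le_mul_of_nonneg_left ?_ hβ
    rw [le_div_iff₀ (hN L)]
    calc plusCorr d β h {0} * #(box d L) = ∑ x ∈ box d L, plusCorr d β h {x} := by
          rw [Finset.sum_congr rfl fun x _ => plusCorr_singleton_eq_zero_site hβ h x, Finset.sum_const, nsmul_eq_mul,
            mul_comm]
      _ ≤ ∑ x ∈ box d L, isingCorr (zdGraph d) (box d L) β h .plus {x} :=
          Finset.sum_le_sum fun x _ => plusCorr_singleton_le_isingCorr_plus_box hβ h x L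
  exact ge_of_tendsto' (tendsto_slope_of_tendsto (S := univ)
    (f := fun (L : ℕ) (t : ℝ) => pressureIn (zdGraph d) (box d L) β t .plus)
    (fun t _ => (hasBoxLimit_pressureIn_holds (d := d) β t .plus :)) (mem_univ h) (mem_univ y)) hslope

/-- **`slope ψ(β,·) y h ≤ β ⟨σ_0⟩⁻_{β,h}` for every `y < h`** (`β ≥ 0`, any real `h`): the finite-volume pressures
`ψ⁻_{B(L)}(β,·)` are convex with derivative `β |B(L)|⁻¹ Σ_x ⟨σ_x⟩⁻_{B(L);β,h} ≤ β ⟨σ_0⟩⁻_{β,h}` at `h`.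
[cite: FriedliVelenik2017, Prop. 3.29 and eq. (3.47); Thm. 3.6] -/
theorem slope_pressure_field_le_mul_minusCorr {β : ℝ} (hβ : 0 ≤ β) {h y : ℝ} (hyh : y < h) :
    slope (fun t => pressure d β t) y h ≤ β * minusCorr d β h {0} := by
  have hN : ∀ L : ℕ, (0 : ℝ) < #(box d L) := fun L => by exact_mod_cast Finset.card_pos.2 (box_nonempty d L)
  have hslope : ∀ L : ℕ, slope (fun t => pressureIn (zdGraph d) (box d L) β t .minus) y h ≤ β * minusCorr d β h {0} := by
    intro L
    refine le_trans ((convexOn_pressureIn_field (zdGraph d) (box d L) β .minus).slope_le_of_hasDerivAt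
      (mem_univ y) (mem_univ h) hyh (hasDerivAt_pressureIn_field (zdGraph d) (box d L) β h .minus)) ?_
    refine mul_le_mul_of_nonneg_left ?_ hβ
    rw [div_le_iff₀ (hN L)]
    calc ∑ x ∈ box d L, isingCorr (zdGraph d) (box d L) β h .minus {x} ≤ ∑ x ∈ box d L, minusCorr d β h {x} :=
          Finset.sum_le_sum fun x _ => isingCorr_minus_box_singleton_le_minusCorr hβ h x L
      _ = minusCorr d β h {0} * #(box d L) := by
          rw [Finset.sum_congr rfl fun x _ => minusCorr_singleton_eq_zero_site hβ h x, Finset.sum_const, nsmul_eq_mul,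
            mul_comm]
  exact le_of_tendsto' (tendsto_slope_of_tendsto (S := univ)
    (f := fun (L : ℕ) (t : ℝ) => pressureIn (zdGraph d) (box d L) β t .minus)
    (fun t _ => (hasBoxLimit_pressureIn_holds (d := d) β t .minus :)) (mem_univ y) (mem_univ h)) hslope

/-! ### Differentiability of `ψ(β,·)` at `h` forces `m⁻(β,h) = m⁺(β,h)` -/

/-- **If `ψ(β,·)` is differentiable at `h` then `⟨σ_0⟩⁻_{β,h} = ⟨σ_0⟩⁺_{β,h}`** (`β > 0`, any real `h`):
`β m⁺(β,h) ≤ ∂⁺ψ = ψ'(h) = ∂⁻ψ ≤ β m⁻(β,h)` and `m⁻ ≤ m⁺`. [cite: FriedliVelenik2017, Thm. 3.34 (proof of 1 ⇒ 3) and Prop. 3.29] -/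
theorem minusCorr_singleton_eq_plusCorr_singleton_of_differentiableAt {β : ℝ} (hβ : 0 < β) {h : ℝ}
    (hd : DifferentiableAt ℝ (fun t => pressure d β t) h) :
    minusCorr d β h {0} = plusCorr d β h {0} := by
  have hD := hd.hasDerivAt.tendsto_slope
  -- from the right: `β m⁺ ≤ ψ'(h)`
  have h1 : β * plusCorr d β h {0} ≤ deriv (fun t => pressure d β t) h := by
    refine ge_of_tendsto (hD.mono_left (nhdsGT_le_nhdsNE h)) ?_
    filter_upwards [self_mem_nhdsWithin] with y hy
    exact mul_plusCorr_le_slope_pressure_field hβ.le hy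
  -- from the left: `ψ'(h) ≤ β m⁻`
  have h2 : deriv (fun t => pressure d β t) h ≤ β * minusCorr d β h {0} := by
    refine le_of_tendsto (hD.mono_left (nhdsLT_le_nhdsNE h)) ?_
    filter_upwards [self_mem_nhdsWithin] with y hy
    rw [slope_comm]
    exact slope_pressure_field_le_mul_minusCorr hβ.le hy
  have h3 : plusCorr d β h {0} ≤ minusCorr d β h {0} := le_of_mul_le_mul_left (h1.trans h2) hβ
  exact le_antisymm (minusCorr_singleton_le_plusCorr_singleton hβ.le h 0) h3

/-! ### UNIQUENESS OF THE GIBBS MEASURE -/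

/-- **FRIEDLI–VELENIK THM. 3.34, `1 ⇒` UNIQUENESS, AT EVERY FIELD**: for the nearest-neighbour Ising model on `ℤ^d`,
`β > 0` and any real `h`, if `ψ(β,·)` is differentiable at `h` then the Ising specification at `(β,h)` has EXACTLY ONE
infinite-volume Gibbs measure. (The single-site gaps `μ⁺_{B(n);β,h}(σ_i = 1) − μ⁻_{B(n);β,h}(σ_i = 1) =
(⟨σ_i⟩⁺_{B(n)} − ⟨σ_i⟩⁻_{B(n)})/2` tend to `(⟨σ_0⟩⁺_{β,h} − ⟨σ_0⟩⁻_{β,h})/2 = 0`; DLR sandwich criterion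
`subsingleton_gibbsMeasures_isingSpecification_of_tendsto`; existence `exists_plusMeasure_holds`.)
[cite: FriedliVelenik2017, Thm. 3.34 and Thm. 3.28, eq. (6.70)] -/
theorem hasUniqueGibbsMeasure_of_differentiableAt_pressure {β : ℝ} (hβ : 0 < β) {h : ℝ}
    (hd : DifferentiableAt ℝ (fun t => pressure d β t) h) :
    HasUniqueGibbsMeasure (isingSpecification (zdGraph d) β h) := by
  have heq := minusCorr_singleton_eq_plusCorr_singleton_of_differentiableAt (d := d) hβ hd
  refine ⟨subsingleton_gibbsMeasures_isingSpecification_of_tendsto (zdGraph d) hβ.le h (box d) fun i => ?_, ?_⟩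
  · have hp : Tendsto (fun n => isingExpect (zdGraph d) (box d n) β h .plus (spinAt i)) atTop
        (𝓝 (plusCorr d β h {i})) := by
      have := tendsto_isingCorr_plus_box (d := d) hβ.le h {i}
      simp only [isingCorr, spinProduct_singleton] at this
      exact this
    have hm : Tendsto (fun n => isingExpect (zdGraph d) (box d n) β h .minus (spinAt i)) atTop
        (𝓝 (minusCorr d β h {i})) := by
      have := tendsto_isingCorr_minus_box (d := d) hβ.le h {i}
      simp only [isingCorr, spinProduct_singleton] at this
      exact this
    have hlim := ((hp.const_add 1).div_const 2).sub ((hm.const_add 1).div_const 2)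
    rw [plusCorr_singleton_eq_zero_site hβ.le h i, minusCorr_singleton_eq_zero_site hβ.le h i, heq, sub_self] at hlim
    refine hlim.congr fun n => ?_
    rw [measureReal_eq_one_eq, measureReal_eq_one_eq]
  · obtain ⟨μ, hμ, -, -⟩ := exists_plusMeasure_holds (d := d) (β := β) (h := h) hβ.le
    exact ⟨μ, hμ⟩

/-- **FRIEDLI–VELENIK THM. 3.25 (1), IN DLR FORM AND WITHOUT LEE–YANG: AT EVERY NONZERO FIELD THE NEAREST-NEIGHBOUR
ISING MODEL ON `ℤ^d` (`d ≥ 1`) HAS A UNIQUE INFINITE-VOLUME GIBBS MEASURE, FOR EVERY `β > 0`** — `ψ(β,·)` is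
differentiable at every `h ≠ 0` (`hasDerivAt_pressure_field`, GHS concavity route).
[cite: FriedliVelenik2017, Thm. 3.25 (1), p. 116; Thm. 3.34] -/
theorem hasUniqueGibbsMeasure_of_field_ne_zero (hd : 1 ≤ d) {β h : ℝ} (hβ : 0 < β) (hh : h ≠ 0) :
    HasUniqueGibbsMeasure (isingSpecification (zdGraph d) β h) := by
  refine hasUniqueGibbsMeasure_of_differentiableAt_pressure hβ ?_
  rcases hh.lt_or_gt with hneg | hpos
  · exact (hasDerivAt_pressure_field_of_neg hd hβ.le hneg).differentiableAt
  · exact (hasDerivAt_pressure_field hd hβ.le hpos).differentiableAt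

/-- Uniqueness in a positive field (`d ≥ 1`, `β > 0`, `h > 0`). [cite: FriedliVelenik2017, Thm. 3.25 (1)] -/
theorem hasUniqueGibbsMeasure_of_pos_field (hd : 1 ≤ d) {β h : ℝ} (hβ : 0 < β) (hh : 0 < h) :
    HasUniqueGibbsMeasure (isingSpecification (zdGraph d) β h) :=
  hasUniqueGibbsMeasure_of_field_ne_zero hd hβ hh.ne'

/-- **The zero-field uniqueness for `0 < β ≤ β_c(d)`, `d ≥ 2`, through the same door** (the pressure is
differentiable in `h` at `0` for `β ≤ β_c`, tree theorem `differentiableAt_pressure_zero_of_le_criticalBeta`, i.e.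
`m*(β) = 0`): the tree's `hasUniqueGibbsMeasure_of_lt_criticalBeta_holds` / `hasUniqueGibbsMeasure_criticalBeta_holds`
re-derived. [cite: FriedliVelenik2017, Thm. 3.34 and Thm. 3.25 (2); AizenmanDuminilCopinSidoraviciusCMP2015, Thm. 1.2] -/
theorem hasUniqueGibbsMeasure_of_le_criticalBeta' (hd : 2 ≤ d) {β : ℝ} (hβ : 0 < β) (hβc : β ≤ criticalBeta d) :
    HasUniqueGibbsMeasure (isingSpecification (zdGraph d) β 0) :=
  hasUniqueGibbsMeasure_of_differentiableAt_pressure hβ (differentiableAt_pressure_zero_of_le_criticalBeta hd hβ hβc)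

/-- **At `h ≠ 0` every infinite-volume Gibbs state is the plus state**: for `d ≥ 1`, `β > 0`, `h ≠ 0`, `μ ∈ 𝒢(β,h)` and
every finite `A`, `⟨σ_A⟩_μ = ⟨σ_A⟩⁺_{β,h}`. [cite: FriedliVelenik2017, Thm. 3.25 (1) and Thm. 6.26] -/
theorem spinCorr_eq_plusCorr_of_field_ne_zero (hd : 1 ≤ d) {β h : ℝ} (hβ : 0 < β) (hh : h ≠ 0)
    {μ : Measure (SpinConfig (Site d))} (hμ : μ ∈ isingGibbsMeasures d β h) (A : Finset (Site d)) :
    spinCorr μ A = plusCorr d β h A := by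
  obtain ⟨μp, hμp, -, hcorr⟩ := exists_plusMeasure_holds (d := d) (β := β) (h := h) hβ.le
  have hμμp : μ = μp := (hasUniqueGibbsMeasure_of_field_ne_zero hd hβ hh).1 hμ hμp
  rw [hμμp]
  exact hcorr A

end IsingSusceptibility

end Summit.CriticalPhenomena.PercolationContinuityZ3.Theorems.FK

end
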